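import Literature.AlgebraicGeometry.GroupSchemes.EtaleClosureOfFiniteSubgroupOfSections
import HarnessLib

/-!
# Closer for `stub_b4g_etaleClosureOfGenericSubgroup_henselian` of `Cruxes/HLiu418/Lines/F0_P6b_ConnectedEtale.lean` ED. 2 (σ2 «SECTIONS FIRST»)

Summit-side THEOREM file (cell `pub/hodgecm-mathlib`, FLOOR 0, P6 «MOD programme», sub-line P6b «CONNECTED–ÉTALE», desk F0P6b-plan (g0) deals
13:42:14Z ∕ 13:52:10Z; prover B-p12 (g30), strategy σ2 «SECTIONS FIRST» (twin σ1 F0P6-p10 (g0) yielded 13:52:09Z); `--supports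
stmt-HodgeConjecture-24832` (HLiu418)).  ONE theorem, `stub_b4g_etaleClosureOfGenericSubgroup_henselian`, whose TYPE is the text of the stub
`stub_b4g_etaleClosureOfGenericSubgroup_henselian` (cand ED. 2 v2 `F0/P6/F0P6b-plan/F0_P6b_ConnectedEtale.ed2.cand.v2.F0P6bplan-g0.lean`,
sha16 dca78db9913a38aa, :168) with the line's predicate `IsUnitComponent G G₀ j := IsMonHom j ∧ IsOpenImmersion j.left ∧ IsClosedImmersion j.left
∧ ConnectedSpace G₀.left` UNFOLDED (a `Theorems` file may not import a `Cruxes/…/Lines` workfile — the line imports the closer); the desk folds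
`stub_b4g_… := <this>` by `exact` (δ-unfolding), and ED. 1's `stub_b4_…` (valuation ring of an algebraically closed field) follows in-file via ★
`ValuationSubring.henselianLocalRing_of_isAlgClosed`.
PROOF = ★ `Literature.AlgebraicGeometry.GroupSchemes.FiniteSubgroupOfSections.injective_reduction_and_exists_etale_closedSubgroup` (organ
`GroupSchemes/EtaleClosureOfFiniteSubgroupOfSections`: (i) injective reduction on `C` from ★ `UnitComponent.exists_factor_iff_reduction_eq_unit`
(b1b generic, F0P6-p11 (g0)) applied to `s₁s₂⁻¹`; (ii) the closure `C̄ = Spec (Γ(G) ⧸ ⋂_{s∈C} ker φ_s) ≅ ∐_C Spec R` — CRT ★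
`Ideal.surjective_pi_of_pairwise_comap_maximalIdeal_ne`, Hopf ideal ★ `AffineGroupScheme.isHopfIdeal_ker_pi`, closed subgroup scheme ★
`AffineGroupScheme.exists_grpObj_isMonHom_quotIncl` (B-p04 (g36)), points ★ `Idempotents.PiAlgebraCharacters`).  HC_CM is proved only modulo the
printed citations until rung 0 closes; this file changes no count.

## References
* [Tate1997FiniteFlatGroupSchemes] J. Tate, *Finite flat group schemes* (1997), (3.7).
* [SerreTate1968] J.-P. Serre, J. Tate, *Good reduction of abelian varieties* (1968), §1 Lemma 1.
* [StacksProject] The Stacks Project, Tag 04GG.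
-/

set_option autoImplicit false
set_option linter.dupNamespace false  -- `Summit.HodgeConjecture.HodgeConjecture.…` BY DESIGN (D-0017), as in every closer of this cell

noncomputable section

open CategoryTheory CategoryTheory.Limits AlgebraicGeometry MonoidalCategory CartesianMonoidalCategory IsLocalRing

open scoped MonObj

namespace Summit.HodgeConjecture.HodgeConjecture.Cruxes.HLiu418.F0P6bConnectedEtaleStubB4g

/-- **`stub_b4g_etaleClosureOfGenericSubgroup_henselian` (σ2 «SECTIONS FIRST»)** — over ANY henselian local ring `R`, `G` finite over
`Spec R` (no flatness) with unit component `j : G₀ ↪ G` (the text of the line's `IsUnitComponent G G₀ j`, unfolded), `C` a finite subgroup of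
the sections `G(R)` meeting `G₀(R)` trivially.  THEN (i) the reduction map is injective on `C` and (ii) there is a closed subgroup scheme
`c : C̄ ↪ G`, FINITE ÉTALE over `Spec R`, whose sections are exactly `C`.  `:=` ★ `FiniteSubgroupOfSections.injective_reduction_and_exists_etale_closedSubgroup`.
[cite: Tate1997FiniteFlatGroupSchemes, (3.7)] [cite: SerreTate1968, §1 Lemma 1] [cite: StacksProject, Tag 04GG] -/
theorem stub_b4g_etaleClosureOfGenericSubgroup_henselian :
    ∀ (R : Type) [CommRing R] [HenselianLocalRing R] (G G₀ : Over (Spec (.of R))) [GrpObj G] [GrpObj G₀] (j : G₀ ⟶ G),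
      IsFinite G.hom → (IsMonHom j ∧ IsOpenImmersion j.left ∧ IsClosedImmersion j.left ∧ ConnectedSpace G₀.left) →
        ∀ (C : Subgroup (𝟙_ (Over (Spec (.of R))) ⟶ G)), (C : Set (𝟙_ (Over (Spec (.of R))) ⟶ G)).Finite →
          (∀ s ∈ C, (∃ s₀ : 𝟙_ (Over (Spec (.of R))) ⟶ G₀, s₀ ≫ j = s) → s = 1) →
            (∀ s₁ ∈ C, ∀ s₂ ∈ C,
                Spec.map (CommRingCat.ofHom (residue R)) ≫ s₁.left = Spec.map (CommRingCat.ofHom (residue R)) ≫ s₂.left →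
                  s₁ = s₂) ∧
            ∃ (Cbar : Over (Spec (.of R))) (_ : GrpObj Cbar) (c : Cbar ⟶ G),
              IsMonHom c ∧ IsClosedImmersion c.left ∧ IsFinite Cbar.hom ∧ Etale Cbar.hom ∧
                ∀ s : 𝟙_ (Over (Spec (.of R))) ⟶ G, s ∈ C ↔ ∃ sbar : 𝟙_ (Over (Spec (.of R))) ⟶ Cbar, sbar ≫ c = s :=
  fun R _ _ G G₀ _ _ j hG hj C hC hC₀ =>
    haveI := hG
    haveI : IsMonHom j := hj.1
    haveI : IsOpenImmersion j.left := hj.2.1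
    haveI : IsClosedImmersion j.left := hj.2.2.1
    haveI : ConnectedSpace G₀.left := hj.2.2.2
    Literature.AlgebraicGeometry.GroupSchemes.FiniteSubgroupOfSections.injective_reduction_and_exists_etale_closedSubgroup R G G₀ j C hC hC₀

end Summit.HodgeConjecture.HodgeConjecture.Cruxes.HLiu418.F0P6bConnectedEtaleStubB4g

end
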